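import Literature.NumberTheory.EllipticCurves.Sprung2024.ChromaticSmallControlProofs
import Literature.NumberTheory.EllipticCurves.Sprung2012.SharpFlatKatoDivisibility
import Literature.NumberTheory.EllipticCurves.IwasawaSelmerModuleFiniteProofs
import Literature.NumberTheory.EllipticCurves.IwasawaSelmerTorsionProofs
import Literature.NumberTheory.EllipticCurves.IwasawaEulerCharRankZeroProofs
import HarnessLib

/-!
# The finite-generation half of Sprung's Theorem 1.2 / 7.14, PROVED for every chromatic Selmer dual:
# `X^•(E/K_∞) = Sel^•(E/K_∞)^∨` is a finitely generated `Λ`-module; and `Sel^•(E/K_∞)^γ` finite ⟹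
# `X^•` is `Λ`-torsion with `f(0) ≠ 0`

`Proofs` file (theorems only; no definition, no named fact; `#print axioms` standard) next to
`Sprung2012/SharpFlatKatoDivisibility.lean` (the NAMED FACT `thm714_sharpFlatSelmerDual_finite_torsion`:
F. Sprung, *Iwasawa theory for elliptic curves at supersingular primes: A pair of main conjectures*,
J. Number Theory **132** (2012), Thm. 1.2 (p. 1486) / Thm. 7.14 (p. 1504): "`X^*(E/ℚ_∞)` … is a
finitely generated torsion `ℤ_p[[X]]`-module" for the colour with `L^* ≠ 0`). WORD FOR WORD the `±`
twin `Kobayashi2003/SignedSelmerModuleFiniteProofs.lean` with `SignedSelmerDualData ↦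
Sprung2012.SharpFlatSelmerDualData`, `signedSelmerInfty ↦ sharpFlatSelmerInfty`, using the dual-pair
structure `SharpFlatSelmerDualData.isDualPair` of `Sprung2024/ChromaticSmallControlProofs.lean`. Of the
fact's two clauses the FIRST — finite generation — holds for a completely general reason and is proved
OUTRIGHT here, for every number field `K`, elliptic `E/K`, prime `p`, `ℤ_p`-extension `κ` with
topological generator `γ`, embedding `ι`, data `(ap, g, c)`, colour `•` and datum `D`:

* `SharpFlatSelmerDualData.moduleFinite` — **`Module.Finite (IwasawaAlgebra p) D.X`**: Nakayama for
  Pontryagin duals (`IwasawaDual.IsDualPair.module_finite`; Greenberg LNM 1716 §1 p. 60) needs only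
  the finiteness of `Sel^•_∞[p] ∩ ker(conj_γ − 1)`, which injects into the finite `Sel_∞[p]^γ`
  (`WeierstrassCurve.finite_setOf_selmerInfty_pTorsion_conjH1_eq_of_isTopGenerator`) along
  `Sel^•(E/K_∞) ≤ Sel_{p^∞}(E/K_∞)` (`sharpFlatSelmerInfty_le_selmerInfty`);
* `SharpFlatSelmerDualData.isTorsion_of_finite_endInvariants` — **`Sel^•(E/K_∞)^γ` finite ⟹ `X^•`
  is `Λ`-torsion** (Greenberg, proof of Thm. 1.4, p. 61), and
  `…order_eq_zero_and_constantCoeff_ne_zero_of_finite_endInvariants` — then every generator `f` of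
  `char(X^•)` has `ord_T f = 0`, `f(0) ≠ 0` (Greenberg's Lemma 4.2, p. 102);
* `Sprung2012.thm714_moduleFinite_holds` — the finite-generation clause of the named fact in its own
  binder shape, now a theorem; `thm714_sharpFlatSelmerDual_finite_torsion_iff_isTorsion` — the fact
  is EQUIVALENT to its torsion clause (Kato's theorem through the ♯/♭ Coleman maps, Sprung 2012
  §7, which stays the fact's content).

With `Sprung2024/ChromaticSmallControlProofs.lean` (Lemma 5.6 ⟸ the `v = p` clause of Lemma 5.5)
this gives, on the classes where `Sel_{p^∞}(E/ℚ)` is finite, the torsion of `X^•` WITHOUT Thm. 7.14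
— used by the consumer `Theorems/SignedLowerHalvesSprungLowerHalfAtThreeSplitConverseLocal.lean` for a
Kato-free (conv₀) road. HONEST FRAMING (cell `bsd-ssimc`, seat `bsd-ssimc-k3c5-kdot-split` g5): nothing
about any curve's torsion-ness is asserted; nothing is booked; no census cell moves; BSD is not proved
by any of this.

References: [Sprung2012] Thm. 1.2 (p. 1486), Def. 7.11 (p. 1503), Thm. 7.14 (p. 1504);
[Kobayashi2003] Thm. 1.2 and Def. 1.1 (p. 2); [GreenbergLNM1716] §1 p. 60 (Nakayama), p. 61 (proof
of Thm. 1.4), §4 Lemma 4.2 (p. 102); [Lang1990] S. Lang, *Cyclotomic Fields I and II*, Ch. 5 §1.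
-/

noncomputable section

open scoped Classical NumberField MatrixGroups ModularForm

open NumberField IsDedekindDomain CongruenceSubgroup Literature.NumberTheory.EllipticCurves
  Literature.NumberTheory.EllipticCurves.IwasawaAlgebra Literature.NumberTheory.EllipticCurves.IwasawaDual
  Literature.NumberTheory.EllipticCurves.ModularForms WeierstrassCurve ZpExtension

universe u

namespace Literature.NumberTheory.EllipticCurves.Sprung2012

open Literature.NumberTheory.EllipticCurves.Sprung2017

variable {K : Type u} [Field K] [NumberField K] (W : WeierstrassCurve K) {p : ℕ} [Fact p.Prime]
  (κ : ZpExtension K p) {E : Type u} [Field E] [Algebra K E]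
  (ι : AlgebraicClosure K →ₐ[K] AlgebraicClosure E) (ap : ℤ) (g : Field.absoluteGaloisGroup E)
  (c : ℕ → localPoints W E) (col : Chroma)

namespace SharpFlatSelmerDualData

variable {W κ ι ap g c col}

/-- **`X^•(E/K_∞)` is a finitely generated `Λ`-module — the finite-generation half of Sprung's
Thm. 1.2 / 7.14, for every number field `K`, elliptic `E/K`, prime `p`, `ℤ_p`-extension `κ` with
topological generator `γ`, embedding, data, colour and datum `D`.** Nakayama for duals
(`IsDualPair.module_finite`) needs only the finiteness of `Sel^•_∞[p] ∩ ker(conj_γ − 1)`, which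
injects into the finite set `Sel_∞[p]^γ` (`finite_setOf_selmerInfty_pTorsion_conjH1_eq_of_isTopGenerator`)
along `Sel^•(E/K_∞) ≤ Sel_{p^∞}(E/K_∞)` (`sharpFlatSelmerInfty_le_selmerInfty`). Word for word
`Kobayashi2003.SignedSelmerDualData.moduleFinite`.
[cite: Sprung2012, Thm. 1.2 (p. 1486; the finite-generation clause)] [cite: GreenbergLNM1716, §1 p. 60 (after Conj. 1.3)] -/
theorem moduleFinite [W.IsElliptic] {γ : Field.absoluteGaloisGroup K} (hγ : κ.IsTopGenerator γ)
    (D : SharpFlatSelmerDualData W κ γ ι ap g c col) : Module.Finite (IwasawaAlgebra p) D.X := by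
  refine (D.isDualPair hγ).module_finite ?_
  have hfin := W.finite_setOf_selmerInfty_pTorsion_conjH1_eq_of_isTopGenerator κ hγ
  let j : sharpFlatSelmerInfty W κ ι ap g c col → W.selmerInfty κ := fun s ↦
    ⟨(s : W.subgroupH1 p κ.kerSubgroup), sharpFlatSelmerInfty_le_selmerInfty W κ ι ap g c col s.2⟩
  have hj : Function.Injective j := fun a b hab ↦ by
    have h : ((j a : W.selmerInfty κ) : W.subgroupH1 p κ.kerSubgroup) = j b := congrArg _ hab
    exact Subtype.ext h
  refine Set.Finite.of_finite_image (hfin.subset ?_) hj.injOn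
  rintro _ ⟨s, hs, rfl⟩
  obtain ⟨hs1, hs2⟩ := IwasawaDual.mem_piece.mp hs
  rw [pow_one] at hs1 hs2
  refine ⟨Subtype.ext ?_, ?_⟩
  · have h := congrArg Subtype.val hs1
    simpa [j] using h
  · have h : (((conjSharpFlatSelmerInfty W κ ι ap g c col γ - 1) s :
        sharpFlatSelmerInfty W κ ι ap g c col) : W.subgroupH1 p κ.kerSubgroup) =
        ((0 : sharpFlatSelmerInfty W κ ι ap g c col) : W.subgroupH1 p κ.kerSubgroup) :=
      congrArg _ hs2
    rw [IwasawaDual.End_sub_apply, AddMonoid.End.one_apply, AddSubgroupClass.coe_sub,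
      coe_conjSharpFlatSelmerInfty_apply, ZeroMemClass.coe_zero, sub_eq_zero] at h
    exact h

/-- **`Sel^•(E/K_∞)^γ` finite ⟹ `X^•(E/K_∞)` is `Λ`-torsion** (any `K`, `κ`, `γ` a topological
generator, embedding, data, colour, `D`): `N = #Sel^•_∞^γ` kills `ker(conj_γ − 1)`, so `N · X ⊆ T · X`
(`IsDualPair.exists_nsmul_eq_X_smul`), and a finitely generated `Λ`-module with `N X ⊆ TX` is
torsion (`isTorsion_of_forall_nsmul_eq_X_smul`, Greenberg's "exercise" in the proof of Thm. 1.4).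
The torsion clause of Thm. 7.14 itself (Kato + Coleman maps) is NOT proved here.
[cite: GreenbergLNM1716, §1 p. 61 (proof of Thm. 1.4)] [cite: Sprung2012, Thm. 7.14 (p. 1504)] -/
theorem isTorsion_of_finite_endInvariants [W.IsElliptic] {γ : Field.absoluteGaloisGroup K}
    (hγ : κ.IsTopGenerator γ) (D : SharpFlatSelmerDualData W κ γ ι ap g c col)
    (hfin : Finite (endInvariants (conjSharpFlatSelmerInfty W κ ι ap g c col γ - 1))) :
    Module.IsTorsion (IwasawaAlgebra p) D.X := by
  haveI := D.moduleFinite hγ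
  have hN0 : Nat.card (endInvariants (conjSharpFlatSelmerInfty W κ ι ap g c col γ - 1)) ≠ 0 :=
    Nat.card_pos.ne'
  refine IwasawaDual.isTorsion_of_forall_nsmul_eq_X_smul hN0 fun x ↦
    (D.isDualPair hγ).exists_nsmul_eq_X_smul ?_ x
  intro s hs
  have hs' : s ∈ endInvariants (conjSharpFlatSelmerInfty W κ ι ap g c col γ - 1) :=
    (mem_endInvariants_iff _ s).mpr hs
  have h1 : Nat.card (endInvariants (conjSharpFlatSelmerInfty W κ ι ap g c col γ - 1)) •
      (⟨s, hs'⟩ : endInvariants (conjSharpFlatSelmerInfty W κ ι ap g c col γ - 1)) = 0 :=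
    card_nsmul_eq_zero'
  have h2 := congrArg Subtype.val h1
  simpa using h2

/-- **`Sel^•(E/K_∞)^γ` finite ⟹ every generator `f` of `char X^•(E/K_∞)` has `ord_T f = 0` and
`f(0) ≠ 0`** (Greenberg's Lemma 4.2 on the dual pair of the chromatic structure; torsion from
`isTorsion_of_finite_endInvariants`). [cite: GreenbergLNM1716, §4 Lemma 4.2 (p. 102)]
[cite: Sprung2024, §5.2 Lemma 5.9 (p. 41)] -/
theorem order_eq_zero_and_constantCoeff_ne_zero_of_finite_endInvariants [W.IsElliptic]
    {γ : Field.absoluteGaloisGroup K} (hγ : κ.IsTopGenerator γ)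
    (D : SharpFlatSelmerDualData W κ γ ι ap g c col)
    (hfin : Finite (endInvariants (conjSharpFlatSelmerInfty W κ ι ap g c col γ - 1)))
    {f : IwasawaAlgebra p} (hf : D.charIdeal = Ideal.span {f}) :
    f.order = 0 ∧ PowerSeries.constantCoeff f ≠ 0 := by
  haveI := D.moduleFinite hγ
  exact (D.isDualPair hγ).order_charGenerator_eq_zero_of_finite_endInvariants
    (D.isTorsion_of_finite_endInvariants hγ hfin) f hf hfin

/-- **`X^•/TX^•` finite ⟹ `X^•` is finitely generated, `Λ`-torsion, and every generator `f` of
`char X^•` has `f(0) ≠ 0`** — the same through Pontryagin duality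
(`SharpFlatSelmerDualData.finite_coinvariants_iff`), in the shape consumed after Sprung 2024's
Lemma 5.6. [cite: GreenbergLNM1716, §4 Lemma 4.2 (p. 102)] [cite: Sprung2024, §5.2 Lemmas 5.6–5.9 (p. 41)] -/
theorem isTorsion_and_constantCoeff_ne_zero_of_finite_coinvariants [W.IsElliptic]
    {γ : Field.absoluteGaloisGroup K} (hγ : κ.IsTopGenerator γ)
    (D : SharpFlatSelmerDualData W κ γ ι ap g c col)
    (hco : Finite (coinvariants p D.X)) {f : IwasawaAlgebra p} (hf : D.charIdeal = Ideal.span {f}) :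
    Module.IsTorsion (IwasawaAlgebra p) D.X ∧ PowerSeries.constantCoeff f ≠ 0 := by
  have hfin := (D.finite_coinvariants_iff hγ).mp hco
  exact ⟨D.isTorsion_of_finite_endInvariants hγ hfin,
    (D.order_eq_zero_and_constantCoeff_ne_zero_of_finite_endInvariants hγ hfin hf).2⟩

end SharpFlatSelmerDualData

/-- **The finite-generation clause of the named fact `thm714_sharpFlatSelmerDual_finite_torsion`, as a
THEOREM** in the fact's own binder shape (`W/ℚ` globally minimal, `p ≠ 2`, good supersingular
reduction, the newform `f`, `κ` cyclotomic with generator `γ`, the place `v ∋ p`, local lift `g`,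
Honda system, Sprung pair with `L^• ≠ 0` — none of which is used beyond `γ` being a topological
generator): for every datum `D`, `Module.Finite (IwasawaAlgebra p) D.X`. The torsion clause remains
the content of the fact. [cite: Sprung2012, Thm. 1.2 (p. 1486; the finite-generation clause)]
[cite: GreenbergLNM1716, §1 p. 60 (after Conj. 1.3)] -/
theorem thm714_moduleFinite_holds (W : WeierstrassCurve ℚ) [W.IsElliptic] [W.IsGloballyMinimal]
    (p : ℕ) [Fact p.Prime] (_hp : p ≠ 2) (_hgood : W.HasGoodReductionAtPrime p)
    (_hss : (p : ℤ) ∣ W.frobeniusTrace p) {N : ℕ} [NeZero N] (f : CuspForm (Gamma0 N) 2)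
    (_hf : IsNewformOf W f) (κ : ZpExtension ℚ p) (γ : Field.absoluteGaloisGroup ℚ)
    (_hκ : κ.IsCyclotomic) (hγ : κ.IsTopGenerator γ) (_hγ' : IsCyclotomicVariable p γ)
    (v : HeightOneSpectrum (𝓞 ℚ)) (_hv : (p : 𝓞 ℚ) ∈ v.asIdeal)
    (g : Field.absoluteGaloisGroup (v.adicCompletion ℚ))
    (_hg : κ.IsTopGenerator (resGalOfEmb (closureEmb (K := ℚ) (v.adicCompletion ℚ)) g))
    (cneg : localPoints W (v.adicCompletion ℚ)) (c : ℕ → localPoints W (v.adicCompletion ℚ))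
    (_hH : IsHondaSystem κ (closureEmb (K := ℚ) (v.adicCompletion ℚ)) W (W.frobeniusTrace p) g cneg c)
    (col : Chroma) (Lsharp Lflat : IwasawaAlgebra p)
    (_hL : IsSprungPair f p (W.frobeniusTrace p) Lsharp Lflat) (_hL0 : chromaticL col Lsharp Lflat ≠ 0)
    (D : SharpFlatSelmerDualData W κ γ (closureEmb (K := ℚ) (v.adicCompletion ℚ))
      (W.frobeniusTrace p) g c col) :
    Module.Finite (IwasawaAlgebra p) D.X :=
  D.moduleFinite hγ

/-- Hence the named fact `thm714_sharpFlatSelmerDual_finite_torsion` is EQUIVALENT to its torsion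
clause alone ("`Sel^•(E/ℚ_∞)` is `Λ`-cotorsion" for the colour with `L^• ≠ 0`).
[cite: Sprung2012, Thm. 1.2 (p. 1486) and Thm. 7.14 (p. 1504)] -/
theorem thm714_sharpFlatSelmerDual_finite_torsion_iff_isTorsion :
    thm714_sharpFlatSelmerDual_finite_torsion ↔
      ∀ (W : WeierstrassCurve ℚ) [W.IsElliptic] [W.IsGloballyMinimal] (p : ℕ) [Fact p.Prime],
        p ≠ 2 → W.HasGoodReductionAtPrime p → (p : ℤ) ∣ W.frobeniusTrace p →
        ∀ {N : ℕ} [NeZero N] (f : CuspForm (Gamma0 N) 2), IsNewformOf W f →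
        ∀ (κ : ZpExtension ℚ p) (γ : Field.absoluteGaloisGroup ℚ),
          κ.IsCyclotomic → κ.IsTopGenerator γ → IsCyclotomicVariable p γ →
        ∀ (v : HeightOneSpectrum (𝓞 ℚ)), (p : 𝓞 ℚ) ∈ v.asIdeal →
        ∀ (g : Field.absoluteGaloisGroup (v.adicCompletion ℚ)),
          κ.IsTopGenerator (resGalOfEmb (closureEmb (K := ℚ) (v.adicCompletion ℚ)) g) →
        ∀ (cneg : localPoints W (v.adicCompletion ℚ)) (c : ℕ → localPoints W (v.adicCompletion ℚ)),
          IsHondaSystem κ (closureEmb (K := ℚ) (v.adicCompletion ℚ)) W (W.frobeniusTrace p) g cneg c →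
        ∀ (col : Chroma) (Lsharp Lflat : IwasawaAlgebra p),
          IsSprungPair f p (W.frobeniusTrace p) Lsharp Lflat → chromaticL col Lsharp Lflat ≠ 0 →
        ∀ (D : SharpFlatSelmerDualData W κ γ (closureEmb (K := ℚ) (v.adicCompletion ℚ))
            (W.frobeniusTrace p) g c col),
          Module.IsTorsion (IwasawaAlgebra p) D.X :=
  ⟨fun h W _ _ p _ hp hgood hss _ _ f hf κ γ hκ hγ hγ' v hv g hg cneg c hH col Ls Lf hL hL0 D ↦
      (h W p hp hgood hss f hf κ γ hκ hγ hγ' v hv g hg cneg c hH col Ls Lf hL hL0 D).2,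
    fun h W _ _ p _ hp hgood hss _ _ f hf κ γ hκ hγ hγ' v hv g hg cneg c hH col Ls Lf hL hL0 D ↦
      ⟨thm714_moduleFinite_holds W p hp hgood hss f hf κ γ hκ hγ hγ' v hv g hg cneg c hH col Ls Lf
          hL hL0 D,
        h W p hp hgood hss f hf κ γ hκ hγ hγ' v hv g hg cneg c hH col Ls Lf hL hL0 D⟩⟩

end Literature.NumberTheory.EllipticCurves.Sprung2012

end
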